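import Summits.QuantumFields.BalabanUV.Beta.DecayingKernelNeumann
import Literature.MathematicalPhysics.QuantumFieldTheory.Balaban1983to89.Beta.HessKerRate

/-!
# Beta / DecayingKernelNeumannUnique — the Neumann series of decaying lattice kernels is THE resolvent in the decaying
# class: UNIQUENESS of the decaying solution of `G = A + (G∘V)∘A`, ASSOCIATIVITY of composition for decaying kernels,
# the LEFT recursion `T_{n+1} = A∘(V∘T_n)` and the LEFT identity `G = A + A∘(V∘G)`
# (β sub-cell, BINDER-OWNERS row D4, owner lineage `b2b-balaban-beta-an4`, gen 36; companion of `DecayingKernelNeumann` p212039 —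
# leaf A.4.3's abstract engine of `HOME/b2b-balaban-beta-an4/g36/OUTLINE-D4-NODE-A.md`; answers XREAD C-d4p2-9 INFO-2
# «right identity only (associativity ∕ left identity routine if an instance needs them)» once, so that no instance has to)

HONEST FRAMING (cell rule, verbatim): «discharging `BetaPertH` makes Bałaban's UV stability UNCONDITIONAL — a real constructive-QFT
result; it is NOT the continuum limit and NOT the Clay problem.»  THIS MODULE is [folklore] analysis on `ℤ^D` over the tree's kernel
calculus (`ExpKernelCalculus`, `KernelWard.comp_assoc_of_bound`∕`comp_sub_right`, `HessKerRate.decays_sub`) and this lineage's `DecayingKernelNeumann`; it formalises NO printed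
statement, cites none, mints no `Prop` fact, bounds nothing of Bałaban's, DISCHARGES NOTHING of the wall.  NOT summit progress.

ABSOLUTE RULE (cell, verbatim): «No internally-minted statement may enter as a cited fact. Every hypothesis is either kernel-proved in this
package or a verbatim quotation of a PUBLISHED theorem with page reference. The manuscript(s) under audit are NOT citable for their own
disputed steps — they are the thing under adjudication; programme-internal (2001/route/tribunal) claims are never citable.»

WHY.  `DecayingKernelNeumann.neumann_engine` gives, for kernels `A`, `V` decaying at rate `δ` with `θ = |F|²C_VC_AZl(δ−δ′)² < 1`, a kernel
`G = Σ_n A(VA)ⁿ` decaying at rate `δ′` and solving the RIGHT resolvent identity `G = A + (G∘V)∘A`.  For the identity to DEFINE `G` as «the»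
perturbed propagator (B9 (3.138)'s `G₁ = G₀(I − (Δ′_π + Δ^{(2)}_π)G₀)⁻¹` is an INVERSE, not a series) one wants: (U) every kernel decaying at
rate `δ′ > 0` that solves the identity IS `G`; (L) the left form `G = A + A∘(V∘G)` as well (print writes its perturbation series in either
order).  Both are [folklore]; (U) is a contraction argument in the decay currency (a decaying solution `G′` gives `D = G′ − G` with
`D = (D∘V)∘A`, hence `Decays D (c·θⁿ) δ′` for every `n`, hence `D = 0`), (L) needs ASSOCIATIVITY of `comp` for decaying kernels (the `tsum`s are
conditionally associative: `KernelWard.comp_assoc_of_bound` under a product majorant, which three decaying kernels supply).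

## What is proved ([folklore], sorry-free)
* §1 `decays_comp_mixed'` (fast ∘ slow: rate `δ` ∘ rate `δ′ < δ` decays at `δ′`, the mirror of `decays_comp_mixed`), `decays_zero_of_pow`
  (a kernel decaying with constants `c·θⁿ` for all `n`, `0 ≤ θ < 1`, is `0`), **`comp_assoc_decays`** (`A∘(K∘L) = (A∘K)∘L` for `A`, `L` decaying at
  positive rates and `K` decaying at any rate ≥ 0).
* §2 **UNIQUENESS** `eq_neumann_of_decays`: `0 < δ′`, `θ < 1`, `Decays G′ C′ δ′`, `G′ = A + (G′∘V)∘A` ⇒ `G′ = neumann A V`.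
* §3 the LEFT recursion `comp_comm_nTerm` (`A∘(V∘T_n) = (T_n∘V)∘A`) and `nTerm_succ_left` (`T_{n+1} = A∘(V∘T_n)`); the left-dressed tail
  `abs_compcomp_left_pSum_sub_le`; **`neumann_eq_left`**: `neumann A V = A + A∘(V∘neumann A V)`; `neumann_engine₂` (both identities + uniqueness).
-/

noncomputable section

open Finset Filter Topology
open scoped BigOperators

namespace Summit.QuantumFields.BalabanUV.Beta.DecayingKernelNeumannUnique

open Literature.MathematicalPhysics.QuantumFieldTheory.Balaban1983to89.Beta
open Literature.MathematicalPhysics.QuantumFieldTheory.Balaban1983to89.B12Sec2to5 (l1 l1_nonneg)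
open Literature.MathematicalPhysics.QuantumFieldTheory.Balaban1983to89.Beta.ExpKernelCalculus
  (Site MKer Decays comp Zl Zl_pos Zl_nonneg summable_exp_shift summable_exp_shift' tsum_exp_shift tsum_exp_shift'
   l1_sub_triangle l1_sub_symm)
open Summit.QuantumFields.BalabanUV.Beta.DecayingKernelNeumann

variable {D : ℕ} {F : Type*} [Fintype F]

/-! ## §1 Bricks: the mirrored mixed-rate composition, differences, vanishing, associativity -/

/-- [folklore] Mirror of `exp_split_mixed`: for `0 ≤ δ′`, `e^{−δ|x−y|}·e^{−δ′|y−z|} ≤ e^{−(δ−δ′)|x−y|}·e^{−δ′|x−z|}`. -/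
theorem exp_split_mixed' {δ δ' : ℝ} (h0 : 0 ≤ δ') (x y z : Site D) :
    Real.exp (-δ * l1 (x - y)) * Real.exp (-δ' * l1 (y - z)) ≤
      Real.exp (-(δ - δ') * l1 (x - y)) * Real.exp (-δ' * l1 (x - z)) := by
  rw [← Real.exp_add, ← Real.exp_add, Real.exp_le_exp]
  have ht := l1_sub_triangle x y z
  nlinarith [mul_nonneg h0 (show 0 ≤ l1 (x - y) + l1 (y - z) - l1 (x - z) by linarith)]

/-- [folklore] Termwise bound for `comp A B` with `A` at the FAST rate `δ` and `B` at the slow rate `δ′ ≤ δ`. -/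
theorem abs_compTerm_le_mixed' {A B : MKer D F} {CA CB δ δ' : ℝ} (hA : Decays A CA δ) (hB : Decays B CB δ')
    (h0 : 0 ≤ δ') (x z : Site D) (a b : F) (y : Site D) :
    |∑ f, A x y a f * B y z f b| ≤
      (Fintype.card F : ℝ) * (CA * CB) * Real.exp (-δ' * l1 (x - z)) * Real.exp (-(δ - δ') * l1 (x - y)) := by
  classical
  have hCC : 0 ≤ CA * CB := mul_nonneg (hA.nonneg a) (hB.nonneg a)
  have hC : ∀ f, |A x y a f * B y z f b| ≤
      (CA * CB) * Real.exp (-δ' * l1 (x - z)) * Real.exp (-(δ - δ') * l1 (x - y)) := by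
    intro f
    rw [abs_mul]
    have h2 := hA x y a f
    have h3 := hB y z f b
    calc |A x y a f| * |B y z f b|
        ≤ (CA * Real.exp (-δ * l1 (x - y))) * (CB * Real.exp (-δ' * l1 (y - z))) :=
          mul_le_mul h2 h3 (abs_nonneg _) ((abs_nonneg _).trans h2)
      _ = (CA * CB) * (Real.exp (-δ * l1 (x - y)) * Real.exp (-δ' * l1 (y - z))) := by ring
      _ ≤ (CA * CB) * (Real.exp (-(δ - δ') * l1 (x - y)) * Real.exp (-δ' * l1 (x - z))) :=
          mul_le_mul_of_nonneg_left (exp_split_mixed' h0 x y z) hCC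
      _ = (CA * CB) * Real.exp (-δ' * l1 (x - z)) * Real.exp (-(δ - δ') * l1 (x - y)) := by ring
  calc |∑ f, A x y a f * B y z f b| ≤ ∑ f, |A x y a f * B y z f b| := Finset.abs_sum_le_sum_abs _ _
    _ ≤ ∑ _f : F, (CA * CB) * Real.exp (-δ' * l1 (x - z)) * Real.exp (-(δ - δ') * l1 (x - y)) :=
        Finset.sum_le_sum fun f _ => hC f
    _ = _ := by rw [Finset.sum_const, Finset.card_univ, nsmul_eq_mul]; ring

/-- [folklore] **MIRRORED MIXED-RATE COMPOSITION**: `A` at rate `δ` composed with `B` at rate `δ′ < δ` decays at rate `δ′`, constant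
`|F|·C_A·C_B·Zl(δ − δ′)`. -/
theorem decays_comp_mixed' {A B : MKer D F} {CA CB δ δ' : ℝ} (hA : Decays A CA δ) (hB : Decays B CB δ') (h0 : 0 ≤ δ')
    (h1 : δ' < δ) : Decays (comp A B) ((Fintype.card F : ℝ) * (CA * CB) * Zl D (δ - δ')) δ' := by
  intro x z a b
  unfold ExpKernelCalculus.comp
  have hs := summable_exp_shift (show 0 < δ - δ' by linarith) x
  have hmaj := hs.mul_left ((Fintype.card F : ℝ) * (CA * CB) * Real.exp (-δ' * l1 (x - z)))
  have hb := tsum_of_norm_bounded hmaj.hasSum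
    (fun y => by rw [Real.norm_eq_abs]; exact abs_compTerm_le_mixed' hA hB h0 x z a b y)
  rw [Real.norm_eq_abs] at hb
  refine hb.trans (le_of_eq ?_)
  rw [tsum_mul_left, tsum_exp_shift]
  ring

omit [Fintype F] in
/-- [folklore] A kernel that decays with constants `c·θⁿ` for EVERY `n` (`0 ≤ θ < 1`) vanishes identically. -/
theorem decays_zero_of_pow {K : MKer D F} {c θ δ : ℝ} (hθ0 : 0 ≤ θ) (hθ : θ < 1) (h : ∀ n : ℕ, Decays K (c * θ ^ n) δ) :
    K = 0 := by
  funext x y a b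
  have hlim : Tendsto (fun n : ℕ => c * θ ^ n * Real.exp (-δ * l1 (x - y))) atTop (𝓝 0) := by
    simpa using ((tendsto_pow_atTop_nhds_zero_of_lt_one hθ0 hθ).const_mul c).mul_const (Real.exp (-δ * l1 (x - y)))
  have hle : ∀ n : ℕ, |K x y a b| ≤ c * θ ^ n * Real.exp (-δ * l1 (x - y)) := fun n => h n x y a b
  have h0 : |K x y a b| ≤ 0 := ge_of_tendsto' hlim hle
  exact abs_nonpos_iff.mp h0

/-- [folklore] **ASSOCIATIVITY OF COMPOSITION FOR DECAYING KERNELS**: `A∘(K∘L) = (A∘K)∘L` when `A` and `L` decay at POSITIVE rates and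
`K` decays at some rate `≥ 0` (so is bounded) — the product majorant of `KernelWard.comp_assoc_of_bound` is
`(C_A C_K e^{−δ_A|x−y|})·(C_L e^{−δ_L|z−w|})`. -/
theorem comp_assoc_decays {A K L : MKer D F} {CA CK CL δA δK δL : ℝ} (hA : Decays A CA δA) (hK : Decays K CK δK)
    (hL : Decays L CL δL) (hδA : 0 < δA) (hδK : 0 ≤ δK) (hδL : 0 < δL) :
    comp A (comp K L) = comp (comp A K) L := by
  refine KernelWard.comp_assoc_of_bound fun x w a b => ?_
  have hCA : 0 ≤ CA := hA.nonneg a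
  have hCK : 0 ≤ CK := hK.nonneg a
  have hCL : 0 ≤ CL := hL.nonneg a
  refine ⟨fun y => CA * CK * Real.exp (-δA * l1 (x - y)), fun z => CL * Real.exp (-δL * l1 (z - w)),
    (summable_exp_shift hδA x).mul_left _, (summable_exp_shift' hδL w).mul_left _, fun y => by positivity,
    fun z => by positivity, fun y z f g => ?_⟩
  have h1 : |A x y a f| ≤ CA * Real.exp (-δA * l1 (x - y)) := hA x y a f
  have h2 : |K y z f g| ≤ CK := by
    refine (hK y z f g).trans ?_
    have : Real.exp (-δK * l1 (y - z)) ≤ 1 := by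
      rw [Real.exp_le_one_iff]; nlinarith [l1_nonneg (y - z)]
    simpa using mul_le_mul_of_nonneg_left this hCK
  have h3 : |L z w g b| ≤ CL * Real.exp (-δL * l1 (z - w)) := hL z w g b
  rw [abs_mul, abs_mul]
  calc |A x y a f| * |K y z f g| * |L z w g b|
      ≤ (CA * Real.exp (-δA * l1 (x - y))) * CK * (CL * Real.exp (-δL * l1 (z - w))) :=
        mul_le_mul (mul_le_mul h1 h2 (abs_nonneg _) (by positivity)) h3 (abs_nonneg _) (by positivity)
    _ = CA * CK * Real.exp (-δA * l1 (x - y)) * (CL * Real.exp (-δL * l1 (z - w))) := by ring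

/-! ## §2 UNIQUENESS of the decaying solution of the right resolvent identity -/

/-- [folklore] The homogeneous equation has only the zero decaying solution: `Decays Dk c δ′`, `Dk = (Dk∘V)∘A`, `θ < 1` ⇒ `Dk = 0`
(each pass through the identity multiplies the decay constant by `θ`). -/
theorem eq_zero_of_homogeneous {Dk A V : MKer D F} {c CA CV δ δ' : ℝ} (hD : Decays Dk c δ') (hA : Decays A CA δ)
    (hV : Decays V CV δ) (h0 : 0 ≤ δ') (h1 : δ' < δ) (hθ : theta D F CA CV δ δ' < 1)
    (hfix : Dk = comp (comp Dk V) A) : Dk = 0 := by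
  have hstep : ∀ n : ℕ, Decays Dk (c * theta D F CA CV δ δ' ^ n) δ' := by
    intro n
    induction n with
    | zero => simpa using hD
    | succ n ih =>
      rw [hfix]
      exact decays_congr_const (decays_comp_mixed (decays_comp_mixed ih hV h0 h1) hA h0 h1)
        (by unfold theta; rw [pow_succ]; ring)
  by_cases hF : Nonempty F
  · obtain ⟨a⟩ := hF
    exact decays_zero_of_pow (theta_nonneg (hA.nonneg a) (hV.nonneg a) h1) hθ hstep
  · funext x y a b; exact absurd ⟨a⟩ hF

/-- [folklore] **UNIQUENESS**: any kernel decaying at rate `δ′` (`0 ≤ δ′ < δ`) that solves the right resolvent identity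
`G′ = A + (G′∘V)∘A` is the Neumann series (`θ < 1`). -/
theorem eq_neumann_of_decays {G' A V : MKer D F} {C' CA CV δ δ' : ℝ} (hG' : Decays G' C' δ') (hA : Decays A CA δ)
    (hV : Decays V CV δ) (h0 : 0 ≤ δ') (h1 : δ' < δ) (hθ : theta D F CA CV δ δ' < 1)
    (hfix : G' = A + comp (comp G' V) A) : G' = neumann A V := by
  have hG := decays_neumann hA hV h0 h1 hθ
  have hlin := comp_comp_sub hG' hG hA hV h0 h1
  have hD : G' - neumann A V = comp (comp (G' - neumann A V) V) A := by
    rw [hlin]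
    have hN := neumann_eq hA hV h0 h1 hθ
    -- G′ − G = (A + (G′V)A) − (A + (GV)A)
    conv_lhs => rw [hfix, hN]
    abel
  have hz := eq_zero_of_homogeneous (HessKerRate.decays_sub hG' hG) hA hV h0 h1 hθ hD
  exact sub_eq_zero.mp hz

/-! ## §3 Associativity consequences: the LEFT recursion and the LEFT identity -/

/-- [folklore] `A∘(V∘T_n) = (T_n∘V)∘A` — the left and right Neumann terms agree (associativity applied `n` times); needs `0 < δ′`. -/
theorem comp_comm_nTerm {A V : MKer D F} {CA CV δ δ' : ℝ} (hA : Decays A CA δ) (hV : Decays V CV δ) (h0 : 0 < δ')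
    (h1 : δ' < δ) (n : ℕ) : comp A (comp V (nTerm A V n)) = comp (comp (nTerm A V n) V) A := by
  have hδ : 0 < δ := h0.trans h1
  induction n with
  | zero =>
    rw [nTerm_zero]
    exact comp_assoc_decays hA hV hA hδ hδ.le hδ
  | succ n ih =>
    have hT := decays_nTerm hA hV h0.le h1 n
    have hTV := decays_comp_mixed hT hV h0.le h1
    -- A∘(V∘((T∘V)∘A)) = A∘((V∘(T∘V))∘A) = (A∘(V∘(T∘V)))∘A = ((A∘(V∘T))∘V)∘A … wait: use ih on the inner block
    rw [nTerm_succ]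
    calc comp A (comp V (comp (comp (nTerm A V n) V) A))
        = comp A (comp (comp V (comp (nTerm A V n) V)) A) := by
          rw [comp_assoc_decays hV hTV hA hδ h0.le hδ]
      _ = comp (comp A (comp V (comp (nTerm A V n) V))) A := by
          rw [comp_assoc_decays hA (decays_comp_mixed' hV hTV h0.le h1) hA hδ h0.le hδ]
      _ = comp (comp (comp A (comp V (nTerm A V n))) V) A := by
          rw [comp_assoc_decays hV hT hV hδ h0.le hδ,
            comp_assoc_decays hA (decays_comp_mixed' hV hT h0.le h1) hV hδ h0.le hδ]
      _ = comp (comp (comp (comp (nTerm A V n) V) A) V) A := by rw [ih]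

/-- [folklore] **THE LEFT RECURSION** `T_{n+1} = A∘(V∘T_n)`. -/
theorem nTerm_succ_left {A V : MKer D F} {CA CV δ δ' : ℝ} (hA : Decays A CA δ) (hV : Decays V CV δ) (h0 : 0 < δ')
    (h1 : δ' < δ) (n : ℕ) : nTerm A V (n + 1) = comp A (comp V (nTerm A V n)) := by
  rw [nTerm_succ, comp_comm_nTerm hA hV h0 h1 n]

/-- [folklore] Summability of the middle series of a fast ∘ slow composition. -/
theorem summable_compTerm_mixed' {A B : MKer D F} {CA CB δ δ' : ℝ} (hA : Decays A CA δ) (hB : Decays B CB δ')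
    (h0 : 0 ≤ δ') (h1 : δ' < δ) (x z : Site D) (a b : F) :
    Summable fun y : Site D => ∑ f, A x y a f * B y z f b := by
  refine Summable.of_norm_bounded
    ((summable_exp_shift (show 0 < δ - δ' by linarith) x).mul_left
      ((Fintype.card F : ℝ) * (CA * CB) * Real.exp (-δ' * l1 (x - z)))) (fun y => ?_)
  rw [Real.norm_eq_abs]
  exact abs_compTerm_le_mixed' hA hB h0 x z a b y

/-- [folklore] Linearity of the LEFT dressing `K ↦ A∘(V∘K)` over differences of kernels decaying at rate `δ′`. -/
theorem comp_comp_sub_left {K K' A V : MKer D F} {C C' CA CV δ δ' : ℝ} (hK : Decays K C δ') (hK' : Decays K' C' δ')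
    (hA : Decays A CA δ) (hV : Decays V CV δ) (h0 : 0 ≤ δ') (h1 : δ' < δ) :
    comp A (comp V (K - K')) = comp A (comp V K) - comp A (comp V K') := by
  have hVK : comp V (K - K') = comp V K - comp V K' :=
    KernelWard.comp_sub_right (fun x z a b => summable_compTerm_mixed' hV hK h0 h1 x z a b)
      (fun x z a b => summable_compTerm_mixed' hV hK' h0 h1 x z a b)
  rw [hVK]
  exact KernelWard.comp_sub_right
    (fun x z a b => summable_compTerm_mixed' hA (decays_comp_mixed' hV hK h0 h1) h0 h1 x z a b)
    (fun x z a b => summable_compTerm_mixed' hA (decays_comp_mixed' hV hK' h0 h1) h0 h1 x z a b)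

/-- [folklore] ADDITIVITY BRICK (right slot): composition distributes over a finite sum of kernels in the RIGHT slot, provided every
summand's composition series converges. -/
theorem comp_finsetSum_right {ι : Type*} (s : Finset ι) (A : MKer D F) (K : ι → MKer D F)
    (hs : ∀ i ∈ s, ∀ x z a b, Summable fun y : Site D => ∑ f, A x y a f * K i y z f b) :
    comp A (fun x y a b => ∑ i ∈ s, K i x y a b) = fun x z a b => ∑ i ∈ s, comp A (K i) x z a b := by
  classical
  funext x z a b
  unfold ExpKernelCalculus.comp
  have hterm : ∀ y : Site D, (∑ f, A x y a f * ∑ i ∈ s, K i y z f b) = ∑ i ∈ s, ∑ f, A x y a f * K i y z f b := by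
    intro y
    rw [Finset.sum_comm]
    refine Finset.sum_congr rfl fun f _ => ?_
    rw [Finset.mul_sum]
  simp_rw [hterm]
  exact Summable.tsum_finsetSum (fun i hi => hs i hi x z a b)

/-- The LEFT-dressed partial sum is the shifted partial sum: `A∘(V∘S_N) = Σ_{n<N} T_{n+1}` (right-slot additivity twice, then the
termwise agreement `comp_comm_nTerm` and the right recursion). -/
theorem comp_comp_left_pSum_eq {A V : MKer D F} {CA CV δ δ' : ℝ} (hA : Decays A CA δ) (hV : Decays V CV δ) (h0 : 0 < δ')
    (h1 : δ' < δ) (N : ℕ) :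
    comp A (comp V (pSum A V N)) = fun x z a b => ∑ n ∈ range N, nTerm A V (n + 1) x z a b := by
  have hVS : comp V (pSum A V N) = fun x z a b => ∑ n ∈ range N, comp V (nTerm A V n) x z a b :=
    comp_finsetSum_right (range N) V (fun n => nTerm A V n) (fun n _ x z a b =>
      summable_compTerm_mixed' hV (decays_nTerm hA hV h0.le h1 n) h0.le h1 x z a b)
  rw [hVS]
  have hAVS := comp_finsetSum_right (range N) A (fun n => comp V (nTerm A V n)) (fun n _ x z a b =>
    summable_compTerm_mixed' hA (decays_comp_mixed' hV (decays_nTerm hA hV h0.le h1 n) h0.le h1) h0.le h1 x z a b)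
  rw [hAVS]
  funext x z a b
  refine Finset.sum_congr rfl fun n _ => ?_
  rw [comp_comm_nTerm hA hV h0 h1 n, ← nTerm_succ]

/-- [folklore] **THE LEFT RECURSION FOR THE PARTIAL SUMS**: `S_{N+1} = A + A∘(V∘S_N)`. -/
theorem pSum_succ_eq_left {A V : MKer D F} {CA CV δ δ' : ℝ} (hA : Decays A CA δ) (hV : Decays V CV δ) (h0 : 0 < δ')
    (h1 : δ' < δ) (N : ℕ) : pSum A V (N + 1) = A + comp A (comp V (pSum A V N)) := by
  rw [comp_comp_left_pSum_eq hA hV h0 h1 N]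
  funext x z a b
  show (∑ n ∈ range (N + 1), nTerm A V n x z a b) = A x z a b + ∑ n ∈ range N, nTerm A V (n + 1) x z a b
  rw [Finset.sum_range_succ', nTerm_zero, add_comm]

/-- [folklore] The left-dressed partial sums approximate the left-dressed sum with error `≤ C_A θ^{N+1}/(1−θ)·e^{−δ′|x−z|}`. -/
theorem abs_compcomp_left_pSum_sub_le {A V : MKer D F} {CA CV δ δ' : ℝ} (hA : Decays A CA δ) (hV : Decays V CV δ)
    (h0 : 0 ≤ δ') (h1 : δ' < δ) (hθ : theta D F CA CV δ δ' < 1) (N : ℕ) (x z : Site D) (a b : F) :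
    |comp A (comp V (neumann A V)) x z a b - comp A (comp V (pSum A V N)) x z a b| ≤
      CA * theta D F CA CV δ δ' ^ (N + 1) / (1 - theta D F CA CV δ δ') * Real.exp (-δ' * l1 (x - z)) := by
  have hlin := comp_comp_sub_left (decays_neumann hA hV h0 h1 hθ) (decays_pSum hA hV h0 h1 N) hA hV h0 h1
  rw [show comp A (comp V (neumann A V)) x z a b - comp A (comp V (pSum A V N)) x z a b =
      comp A (comp V (neumann A V - pSum A V N)) x z a b by rw [hlin]; rfl]
  have h := decays_comp_mixed' hA (decays_comp_mixed' hV (decays_neumann_sub_pSum hA hV h0 h1 hθ N) h0 h1) h0 h1 x z a b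
  exact h.trans (le_of_eq (by unfold theta; rw [pow_succ]; ring))

/-- [folklore] The left-dressed partial sums converge pointwise to the left-dressed sum. -/
theorem tendsto_compcomp_left_pSum {A V : MKer D F} {CA CV δ δ' : ℝ} (hA : Decays A CA δ) (hV : Decays V CV δ)
    (h0 : 0 ≤ δ') (h1 : δ' < δ) (hθ : theta D F CA CV δ δ' < 1) (x z : Site D) (a b : F) :
    Tendsto (fun N => comp A (comp V (pSum A V N)) x z a b) atTop (𝓝 (comp A (comp V (neumann A V)) x z a b)) := by
  set θ := theta D F CA CV δ δ' with hθdef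
  set L := comp A (comp V (neumann A V)) x z a b with hL
  set c := CA / (1 - θ) * Real.exp (-δ' * l1 (x - z)) with hc
  have hθ0 : 0 ≤ θ := theta_nonneg (hA.nonneg a) (hV.nonneg a) h1
  have hpow : Tendsto (fun N : ℕ => c * θ ^ (N + 1)) atTop (𝓝 0) := by
    simpa using ((tendsto_pow_atTop_nhds_zero_of_lt_one hθ0 hθ).comp (tendsto_add_atTop_nat 1)).const_mul c
  have hbound : ∀ N, |comp A (comp V (pSum A V N)) x z a b - L| ≤ c * θ ^ (N + 1) := by
    intro N
    rw [abs_sub_comm]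
    refine (abs_compcomp_left_pSum_sub_le hA hV h0 h1 hθ N x z a b).trans (le_of_eq ?_)
    rw [hc]; ring
  have hlo : Tendsto (fun N : ℕ => L - c * θ ^ (N + 1)) atTop (𝓝 L) := by simpa using tendsto_const_nhds (x := L) |>.sub hpow
  have hhi : Tendsto (fun N : ℕ => L + c * θ ^ (N + 1)) atTop (𝓝 L) := by simpa using tendsto_const_nhds (x := L) |>.add hpow
  refine tendsto_of_tendsto_of_tendsto_of_le_of_le hlo hhi (fun N => ?_) (fun N => ?_)
  · have := hbound N; rw [abs_le] at this; linarith [this.1]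
  · have := hbound N; rw [abs_le] at this; linarith [this.2]

/-- [folklore] **THE LEFT RESOLVENT IDENTITY** `G = A + A∘(V∘G)` (for `0 < δ′`: associativity enters through `comp_comm_nTerm`). -/
theorem neumann_eq_left {A V : MKer D F} {CA CV δ δ' : ℝ} (hA : Decays A CA δ) (hV : Decays V CV δ) (h0 : 0 < δ')
    (h1 : δ' < δ) (hθ : theta D F CA CV δ δ' < 1) : neumann A V = A + comp A (comp V (neumann A V)) := by
  funext x z a b
  have hS : Tendsto (fun N => pSum A V (N + 1) x z a b) atTop (𝓝 (neumann A V x z a b)) :=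
    (tendsto_pSum hA hV h0.le h1 hθ x z a b).comp (tendsto_add_atTop_nat 1)
  have hS' : (fun N => pSum A V (N + 1) x z a b) = fun N => A x z a b + comp A (comp V (pSum A V N)) x z a b := by
    funext N
    rw [pSum_succ_eq_left hA hV h0 h1 N]
    rfl
  rw [hS'] at hS
  exact tendsto_nhds_unique hS (tendsto_const_nhds.add (tendsto_compcomp_left_pSum hA hV h0.le h1 hθ x z a b))

/-! ## §4 The engine, completed -/

/-- [folklore] **NEUMANN ENGINE, TWO-SIDED AND UNIQUE.**  For `A`, `V` decaying at rate `δ` with constants `C_A`, `C_V`, `0 < δ′ < δ` and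
`θ = |F|²·C_V·C_A·Zl(δ−δ′)² < 1`: the Neumann kernel `G = Σ_n A(VA)ⁿ` decays at rate `δ′` with constant `C_A/(1−θ)`, solves BOTH resolvent
identities `G = A + (G∘V)∘A = A + A∘(V∘G)`, and is the ONLY kernel decaying at rate `δ′` that solves the right one.  (Decay currency
only; no weighted∕Hölder norms, no localization, no positivity — see `DecayingKernelNeumann`'s header.) -/
theorem neumann_engine₂ {A V : MKer D F} {CA CV δ δ' : ℝ} (hA : Decays A CA δ) (hV : Decays V CV δ) (h0 : 0 < δ')
    (h1 : δ' < δ) (hθ : theta D F CA CV δ δ' < 1) :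
    Decays (neumann A V) (CA / (1 - theta D F CA CV δ δ')) δ' ∧
    neumann A V = A + comp (comp (neumann A V) V) A ∧
    neumann A V = A + comp A (comp V (neumann A V)) ∧
    (∀ (G' : MKer D F) (C' : ℝ), Decays G' C' δ' → G' = A + comp (comp G' V) A → G' = neumann A V) :=
  ⟨decays_neumann hA hV h0.le h1 hθ, neumann_eq hA hV h0.le h1 hθ, neumann_eq_left hA hV h0 h1 hθ,
    fun _ _ hG' hfix => eq_neumann_of_decays hG' hA hV h0.le h1 hθ hfix⟩

end Summit.QuantumFields.BalabanUV.Beta.DecayingKernelNeumannUnique
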